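import Summits.HodgeConjecture.HodgeConjecture.Theorems.HodgeSimilitudeAlgebraic.Negative.FalseWithoutHtype
import Summits.HodgeConjecture.HodgeConjecture.Theorems.NikulinTwinTransportTwinSimilitudeAlgebraicLattice
import Summits.HodgeConjecture.HodgeConjecture.Theorems.NikulinTwinTransportTwinSimilitudeAlgebraicMarkings

/-!
# `TwinSimilitudeAlgebraic` (stmt-HodgeConjecture-13674, X = Sim₂(K3)) · Negative · a non-CM projective period with `End_Hdg(T) = ℚ`

Negative-side helper library for the crux `NikulinTwinTransport.TwinSimilitudeAlgebraic`, extracted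
from the standing disprover's work file `Cruxes/TwinSimilitudeAlgebraic/Disproof.lean` (§3b;
refuter-cdisprove-stmt-HodgeConjecture-13674-0, 2026-08-16). Consumer: `Negative/FalseWithoutHrat`
(the rationality hypothesis of X is load-bearing).

Contents (all PROVED, axioms `propext`, `Classical.choice`, `Quot.sound`):

* the explicit quadratic period `x₁ = (e₁+f₁) + i(√2(e₂+f₂) + (e₂−f₂)) ∈ Λ_ℂ`: `(x₁.x₁) = 0`,
  `(x̄₁.x₁) = 4 > 0`, `(u.x₁) = 0` for `u = e₃+f₃` (`u² = 2`, so the period is PROJECTIVE, `ρ = 19`,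
  `T_ℚ = ⟨e₁+f₁⟩ ⊕ U₂ ≅ ⟨2⟩ ⊕ U` of odd rank 3 — no CM);
* the non-real isometry `R` of `(Λ_ℂ, k3Form)` (`twistR`): `2` on `ℂx₁`, `½` on `ℂx̄₁`, `1` on
  `{x₁, x̄₁}^⊥`; `(R(e₁+f₁))_{e₂} = ¾(√2+1)i ≠ 0`;
* the KEY LEMMA `ratEnd_aV_of_eigen`: an endomorphism of `Λ_ℂ` defined over `ℚ` having `x₁` as an
  eigenvector acts on `e₁+f₁` by the same (real) scalar — the elementary content of
  "`End_Hdg(T) = ℚ`" at `x₁` (Zarhin: `End_Hdg(T)` is a totally real or CM field `E` with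
  `[E:ℚ] ∣ rank T`; here rank `3` and `√2 ∉ ℚ` pin `E = ℚ` by hand).

## References

* [Huybrechts2016K3] D. Huybrechts, Lectures on K3 Surfaces (2016), Ch. 3 §3, Ch. 6 §1.1.
* [Zarhin1983] Yu. G. Zarhin, Hodge groups of K3 surfaces, J. reine angew. Math. 341 (1983), Thm. 1.5.1.
-/

noncomputable section

open CategoryTheory MonoidalCategory
open scoped Manifold Matrix ComplexConjugate
open Literature.AlgebraicGeometry.Motives Literature.AlgebraicGeometry.HodgeTheory
open Literature.AlgebraicGeometry.Surfaces Literature.Geometry.Kaehler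
open Literature.AlgebraicTopology.SingularHomology
open Literature.LinearAlgebra.QuadraticForm
open Summit.HodgeConjecture.HodgeConjecture.Theses.NikulinTwinTransport
open Summit.HodgeConjecture.HodgeConjecture.Theorems.NikulinTwinTransport
open Summit.HodgeConjecture.HodgeConjecture.Theorems.HodgeSimilitudeAlgebraic.Negative

namespace Summit.HodgeConjecture.HodgeConjecture.Theorems.TwinSimilitudeAlgebraic.Negative

/-! ### The non-CM projective period `x₁` -/

/-- `√2` as a complex number. Local notation only. -/
local notation3 (prettyPrint := false) "s2" => ((Real.sqrt 2 : ℝ) : ℂ)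

/-- The explicit NON-CM projective period `x₁ = (e₁+f₁) + i(√2(e₂+f₂) + (e₂−f₂))`: `(x₁.x₁) = 0`,
`(x̄₁.x₁) = 4`, `u = e₃+f₃ ⊥ x₁` with `u² = 2`; `T_ℚ = ⟨e₁+f₁⟩ ⊕ U₂` has rank 3 and
`End_Hdg(T) = ℚ` (`ratEnd_aV_of_eigen`). Local notation only. -/
local notation3 (prettyPrint := false) "x₁P" =>
  (Sum.elim 0 (Sum.elim ![1, 1] (Sum.elim ![(s2 + 1) * Complex.I, (s2 - 1) * Complex.I] 0)) : K3Index → ℂ)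

/-- `a = e₁ + f₁`. Local notation only. -/
local notation3 (prettyPrint := false) "aV" =>
  (Sum.elim 0 (Sum.elim ![1, 1] (Sum.elim 0 0)) : K3Index → ℤ)
/-- `b = e₂ + f₂`. Local notation only. -/
local notation3 (prettyPrint := false) "bV" =>
  (Sum.elim 0 (Sum.elim 0 (Sum.elim ![1, 1] 0)) : K3Index → ℤ)
/-- `d = e₂ - f₂`. Local notation only. -/
local notation3 (prettyPrint := false) "dV" =>
  (Sum.elim 0 (Sum.elim 0 (Sum.elim ![1, -1] 0)) : K3Index → ℤ)
/-- `u = e₃ + f₃`. Local notation only. -/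
local notation3 (prettyPrint := false) "uV" =>
  (Sum.elim 0 (Sum.elim 0 (Sum.elim 0 ![1, 1])) : K3Index → ℤ)

/-- `√2 · √2 = 2` in `ℂ`. [folklore] -/
theorem s2_mul_s2 : s2 * s2 = 2 := by
  rw [← Complex.ofReal_mul, Real.mul_self_sqrt (by norm_num : (0:ℝ) ≤ 2)]
  norm_num

/-- `√2` is real. [folklore] -/
theorem star_s2 : star s2 = s2 := Complex.conj_ofReal _

/-- `√2² = 2` in `ℂ`. [folklore] -/
theorem s2_sq : s2 ^ 2 = 2 := by rw [sq, s2_mul_s2]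

/-- `(x₁.x₁) = 0`. [cite: Huybrechts2016K3, Ch. 6 §1.1] -/
theorem x₁P_sq : k3Form x₁P x₁P = 0 := by
  simp [k3Form, k3Gram, hyperbolicPlaneGram, Fintype.sum_sum_type, Fin.sum_univ_two]
  ring_nf
  rw [Complex.I_sq, s2_sq]
  ring

/-- The conjugate period `x̄₁`. [folklore] -/
theorem star_x₁P : star x₁P =
    (Sum.elim 0 (Sum.elim ![1, 1] (Sum.elim ![-((s2 + 1) * Complex.I), -((s2 - 1) * Complex.I)] 0)) :
      K3Index → ℂ) := by
  funext i
  rcases i with ((i|i)|(i|(i|i))) <;> fin_cases i <;> simp [star_s2]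

/-- `(x̄₁.x₁) = 4`. [cite: Huybrechts2016K3, Ch. 6 §1.1] -/
theorem k3Form_star_x₁P_x₁P : k3Form (star x₁P) x₁P = 4 := by
  rw [star_x₁P]
  simp [k3Form, k3Gram, hyperbolicPlaneGram, Fintype.sum_sum_type, Fin.sum_univ_two]
  ring_nf
  rw [Complex.I_sq, s2_sq]
  ring

/-- `(x₁.x̄₁) = 4`. [folklore] -/
theorem k3Form_x₁P_star_x₁P : k3Form x₁P (star x₁P) = 4 := by
  rw [k3Form_comm, k3Form_star_x₁P_x₁P]

/-- `(x̄₁.x̄₁) = 0`. [folklore] -/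
theorem k3Form_star_x₁P_star_x₁P : k3Form (star x₁P) (star x₁P) = 0 := by
  rw [← star_k3Form, x₁P_sq, star_zero]

/-- `re (x̄₁.x₁) = 4 > 0`: `x₁` is a period point. [cite: Huybrechts2016K3, Ch. 6 §1.1] -/
theorem x₁P_pos : 0 < (k3Form (star x₁P) x₁P).re := by
  rw [k3Form_star_x₁P_x₁P]; norm_num

/-- `(u.x₁) = 0` for `u = e₃ + f₃` (with `u² = 2 > 0`: the period is projective, `ρ = 19`). [folklore] -/
theorem uV_x₁P : k3Form (fun i => (uV i : ℂ)) x₁P = 0 := by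
  simp [k3Form, k3Gram, hyperbolicPlaneGram, Fintype.sum_sum_type, Fin.sum_univ_two]

/-- `(a.x₁) = 2` for `a = e₁ + f₁`. [folklore] -/
theorem k3Form_aV_x₁P : k3Form (fun i => (aV i : ℂ)) x₁P = 2 := by
  simp [k3Form, k3Gram, hyperbolicPlaneGram, Fintype.sum_sum_type, Fin.sum_univ_two]; norm_num

/-- `(x₁.a) = 2`. [folklore] -/
theorem k3Form_x₁P_aV : k3Form x₁P (fun i => (aV i : ℂ)) = 2 := by
  rw [k3Form_comm, k3Form_aV_x₁P]

/-- `(x̄₁.a) = 2`. [folklore] -/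
theorem k3Form_star_x₁P_aV : k3Form (star x₁P) (fun i => (aV i : ℂ)) = 2 := by
  rw [star_x₁P]
  simp [k3Form, k3Gram, hyperbolicPlaneGram, Fintype.sum_sum_type, Fin.sum_univ_two]; norm_num

/-- `x₁ = a + i (√2 b + d)` with `a = e₁+f₁`, `b = e₂+f₂`, `d = e₂−f₂`. [folklore] -/
theorem x₁P_decomp : x₁P = (fun i => (aV i : ℂ)) +
    Complex.I • (s2 • (fun i => (bV i : ℂ)) + (fun i => (dV i : ℂ))) := by
  funext i
  rcases i with ((i|i)|(i|(i|i))) <;> fin_cases i <;> simp <;> ring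

/-! ### The non-rational type-preserving isometry `R` (`t = 2`) -/

/-- `R v = v + ¼ (x̄₁.v) x₁ − ⅛ (x₁.v) x̄₁`: acts by `2` on `x₁`, by `½` on `x̄₁`, by `1` on
`{x₁, x̄₁}^⊥`; an isometry of `(Λ_ℂ, k3Form)` NOT defined over `ℚ` (nor over `ℝ`). [folklore] -/
def twistR : Module.End ℂ (K3Index → ℂ) :=
  1 + (4 : ℂ)⁻¹ • (k3FormC (star x₁P)).smulRight x₁P +
    (-(8 : ℂ)⁻¹) • (k3FormC x₁P).smulRight (star x₁P)

/-- The defining formula of `R`. [folklore] -/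
theorem twistR_apply (v : K3Index → ℂ) :
    twistR v = v + ((4 : ℂ)⁻¹ * k3Form (star x₁P) v) • x₁P +
      (-(8 : ℂ)⁻¹ * k3Form x₁P v) • star x₁P := by
  simp only [twistR, LinearMap.add_apply, LinearMap.smul_apply, LinearMap.smulRight_apply,
    k3FormC_apply, Module.End.one_apply, smul_smul]

/-- `R x₁ = 2 x₁`. [folklore] -/
theorem twistR_x₁P : twistR x₁P = (2 : ℂ) • x₁P := by
  rw [twistR_apply, k3Form_star_x₁P_x₁P, x₁P_sq, mul_zero, zero_smul, add_zero]
  rw [show (2 : ℂ) • x₁P = x₁P + (1 : ℂ) • x₁P by rw [one_smul, ← two_smul ℂ]]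
  congr 1
  norm_num

/-- `R x̄₁ = ½ x̄₁`. [folklore] -/
theorem twistR_star_x₁P : twistR (star x₁P) = (2 : ℂ)⁻¹ • star x₁P := by
  rw [twistR_apply, k3Form_star_x₁P_star_x₁P, k3Form_x₁P_star_x₁P, mul_zero, zero_smul, add_zero]
  rw [show (-(8 : ℂ)⁻¹ * 4) = (2 : ℂ)⁻¹ - 1 by norm_num, sub_smul, one_smul]
  abel

/-- `R` is an isometry of the complex K3 form (`¼ + (−⅛) + 4·¼·(−⅛) = 0`). [folklore] -/
theorem k3Form_twistR (v w : K3Index → ℂ) : k3Form (twistR v) (twistR w) = k3Form v w := by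
  have e1 : k3Form v x₁P = k3Form x₁P v := k3Form_comm _ _
  have e2 : k3Form v (star x₁P) = k3Form (star x₁P) v := k3Form_comm _ _
  rw [twistR_apply, twistR_apply]
  simp only [k3Form_add_left, k3Form_add_right, k3Form_smul_left, k3Form_smul_right, x₁P_sq,
    k3Form_star_x₁P_star_x₁P, k3Form_x₁P_star_x₁P, k3Form_star_x₁P_x₁P, e1, e2]
  ring

/-- `R a = a + ½ x₁ − ¼ x̄₁` for `a = e₁ + f₁`. [folklore] -/
theorem twistR_aV : twistR (fun i => (aV i : ℂ)) =
    (fun i => (aV i : ℂ)) + (2 : ℂ)⁻¹ • x₁P + (-(4 : ℂ)⁻¹) • star x₁P := by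
  rw [twistR_apply, k3Form_star_x₁P_aV, k3Form_x₁P_aV]
  norm_num

/-- The `e₂`-coordinate of `R a` is `¾ (√2 + 1) i` (so `R a ∉ ℂ a` and `R a ∉ Λ_ℚ`). [folklore] -/
theorem twistR_aV_e₂ : twistR (fun i => (aV i : ℂ)) (Sum.inr (Sum.inr (Sum.inl 0))) =
    (3 / 4 : ℂ) * ((s2 + 1) * Complex.I) := by
  rw [twistR_aV, star_x₁P]
  simp
  ring

/-- `(R a)_{e₂} ≠ 0`. [folklore] -/
theorem twistR_aV_e₂_ne_zero : twistR (fun i => (aV i : ℂ)) (Sum.inr (Sum.inr (Sum.inl 0))) ≠ 0 := by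
  rw [twistR_aV_e₂]
  refine mul_ne_zero (by norm_num) (mul_ne_zero ?_ Complex.I_ne_zero)
  intro h
  have h1 : (Real.sqrt 2 : ℝ) + 1 = 0 := by exact_mod_cast h
  have h2 : (0 : ℝ) ≤ Real.sqrt 2 := Real.sqrt_nonneg 2
  linarith


/-! ### KEY LEMMA: `End_Hdg(T) = ℚ` at the period `x₁`, elementary form -/

/-- **Key lemma.** An endomorphism `G` of `Λ_ℂ` defined over `ℚ` having the period `x₁` as an
eigenvector, `G x₁ = λ x₁`, acts on `a = e₁ + f₁` by the same scalar: `G a = λ a` (and `λ` is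
real). Proof: `G x₁ = G a + i(√2 G b + G d)` with `G a, G b, G d ∈ Λ_ℚ`; the real parts of the
`e₂`- and `f₂`-coordinates give `(Ga)_{e₂} = −Im λ (√2+1)`, `(Ga)_{f₂} = −Im λ (√2−1)`, so
`Im λ ≠ 0` would make `√2 = ((Ga)_{e₂} + (Ga)_{f₂}) / ((Ga)_{e₂} − (Ga)_{f₂})` rational; hence
`Im λ = 0` and the real parts of all coordinates give `G a = (Re λ) a`. [folklore] -/
theorem ratEnd_aV_of_eigen (G : Module.End ℂ (K3Index → ℂ))
    (hG : ∀ v : K3Index → ℤ, ∃ w : K3Index → ℚ, G (fun i => (v i : ℂ)) = fun i => (w i : ℂ))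
    {lam : ℂ} (h : G x₁P = lam • x₁P) :
    G (fun i => (aV i : ℂ)) = lam • fun i => (aV i : ℂ) := by
  obtain ⟨wa, hwa⟩ := hG aV
  obtain ⟨wb, hwb⟩ := hG bV
  obtain ⟨wd, hwd⟩ := hG dV
  -- `G x₁ = G a + I • (s2 • G b + G d)`
  have hGx : G x₁P = (fun i => (wa i : ℂ)) +
      Complex.I • (s2 • (fun i => (wb i : ℂ)) + fun i => (wd i : ℂ)) := by
    rw [x₁P_decomp, map_add, map_smul, map_add, map_smul, hwa, hwb, hwd]
  rw [hGx] at h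
  have hc : ∀ i, (wa i : ℂ) + Complex.I * (s2 * (wb i : ℂ) + (wd i : ℂ)) = lam * x₁P i := fun i => by
    have := congrFun h i
    simp only [Pi.add_apply, Pi.smul_apply, smul_eq_mul] at this
    exact this
  -- real parts at `e₂` and `f₂`
  have hre1 : (wa (Sum.inr (Sum.inr (Sum.inl 0))) : ℝ) = -(lam.im * (Real.sqrt 2 + 1)) := by
    have := congrArg Complex.re (hc (Sum.inr (Sum.inr (Sum.inl 0))))
    simpa using this
  have hre2 : (wa (Sum.inr (Sum.inr (Sum.inl 1))) : ℝ) = -(lam.im * (Real.sqrt 2 - 1)) := by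
    have := congrArg Complex.re (hc (Sum.inr (Sum.inr (Sum.inl 1))))
    simpa using this
  -- `Im λ = 0`, by irrationality of `√2`
  have him : lam.im = 0 := by
    by_contra hne
    set p : ℚ := wa (Sum.inr (Sum.inr (Sum.inl 0))) with hp
    set q : ℚ := wa (Sum.inr (Sum.inr (Sum.inl 1))) with hq
    have hd : ((p : ℝ) - q) = -2 * lam.im := by linear_combination hre1 - hre2
    have hs : ((p : ℝ) + q) = (-2 * lam.im) * Real.sqrt 2 := by linear_combination hre1 + hre2
    have hd0 : ((p : ℝ) - q) ≠ 0 := by rw [hd]; exact mul_ne_zero (by norm_num) hne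
    have hsq : Real.sqrt 2 = ((p : ℝ) + q) / ((p : ℝ) - q) := by
      rw [eq_div_iff hd0, hd, hs]; ring
    exact irrational_sqrt_two.ne_rat ((p + q) / (p - q)) (by rw [hsq]; push_cast; rfl)
  -- real parts of all coordinates: `G a = (Re λ) a`
  have hlam : lam = (lam.re : ℂ) := Complex.ext (by simp) (by simp [him])
  rw [hwa]
  funext i
  have hi := hc i
  have hxi : x₁P i = (aV i : ℂ) + Complex.I * (s2 * (bV i : ℂ) + (dV i : ℂ)) := by
    have := congrFun x₁P_decomp i
    simp only [Pi.add_apply, Pi.smul_apply, smul_eq_mul] at this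
    exact this
  rw [hxi] at hi
  have hre := congrArg Complex.re hi
  simp [him] at hre
  rw [Pi.smul_apply, smul_eq_mul, hlam]
  apply Complex.ext
  · simpa using hre
  · simp


end Summit.HodgeConjecture.HodgeConjecture.Theorems.TwinSimilitudeAlgebraic.Negative

end
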